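import Literature.Algebra.Homology.DiscreteRepExtInternalHomPostcomp
import Literature.Algebra.Homology.DiscreteRepStandardResolutionRestriction
import Literature.Algebra.Homology.DiscreteRepRestrictionExact

/-!
# The comparison `Extⁿ_{C_Γ}(N, X) ≃+ Extⁿ_{C_Γ}(triv k, Hom(N, X))` commutes with restriction to a
# subgroup (Harari Prop. 16.16 (b) / Milne ADT I 0.8, compatibility with `Res`)

Topic `Algebra/Homology`; namespace `Literature.Algebra.Homology.DiscreteRep`.  Theorems, one `def`
(the identity isomorphism `resIhomComplexIso`) and four `abbrev`s (cochain maps); no named fact, no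
instance, no `sorry`.  Sequel of door-c4's
`DiscreteRepExtInternalHom` (`extIhomAddEquiv N X hX hN n`, the three-factor comparison
engine ∘ curry ∘ engine) and `DiscreteRepStandardResolutionRestriction` (`stdComplexResMap`, `stdη_res`:
restriction of the standard complex along `U ↪ Γ`), of `ExtOfAcyclicResolutionFunctorialitySquares`
(`extAddEquivHomology{Zero,Succ}_map`: the engine under an exact functor) and
`ExtOfAcyclicResolutionNaturality` (`…_naturality`: the engine along a map of resolutions), and of
`DiscreteRepRestrictionExact` (`resD k U` is exact for EVERY subgroup `U`).

THE MATHEMATICS.  For a compact group `Γ`, a compact subgroup `U` (open of finite index, or closed in a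
profinite `Γ`), `N ∈ C_Γ` finitely generated over `k` and `X` discrete, restriction
`Res : Extⁿ_{C_Γ}(N, X) → Extⁿ_{C_U}(Res N, Res X)` corresponds under the comparison
`Extⁿ(N, X) ≃+ Extⁿ(triv k, Hom(N, X))` (Harari Prop. 16.16 (b)) to `Res` on `Extⁿ(triv k, Hom(N, X))`
— using `Res Hom(N, X) = Hom(Res N, Res X)` (definitional here).  The proof restricts each of the three
factors: the engine on `std• X` in the source `N` (functoriality under the exact functor `Res`, then
naturality along `Res std•_Γ X → std•_U Res X`), the curry isomorphism (`curryExt₀_res`), and the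
engine on `Hom(N, std• X)` in the source `triv k`.  ACYCLICITY INPUTS are carried as hypotheses:
`hN` (`std•_Γ X` is `Ext(N, –)`-acyclic), `hNr` (`Res std•_Γ X` is `Ext(Res N, –)`-acyclic), `hN'`
(`std•_U (Res X)` is `Ext(Res N, –)`-acyclic) and `hHr` (`Res Hom(N, std•_Γ X)` is
`Ext(triv k, –)`-acyclic); they are discharged for `U` open of finite index / `U` closed in a profinite
`Γ` and `N` projective over `k` in the sequel `DiscreteRepExtInternalHomClosedRestriction`.

MAIN RESULTS: `curryExt₀_res`, `extComplexCurryIso_hom_res`, `extTrivIhomAddEquivHomology_res`,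
`extAddEquivStdHomology_res`, **`extIhomAddEquiv_res`**:
`Res (extIhomAddEquiv N X x) = extIhomAddEquiv (Res N) (Res X) (Res x)`.
Written for the background lane «PT-Ш-S-TC» of crux `stmt-BirchSwinnertonDyer-19032` (cell bsd-eis,
seat bsd-line-x1-p1-w3 gen 18, piece (Λ)(iii)(a)): the `Res_{D_v}`-half of the local square (Λ1)
for the comparison `cmp` of Milne's `Ext` road.  HONEST FRAMING: homological algebra only; no duality
theorem and no case of BSD is proved here.

## References
* D. Harari, *Galois Cohomology and Class Field Theory*, Universitext (2020), §16.2 Prop. 16.16 (b)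
  (p. 271), Theorem 16.14 (proof, (16.2)), §4.3 (2) (restriction for profinite groups) and Remark 4.24.
  [Harari2020]
* J. S. Milne, *Arithmetic Duality Theorems*, 2nd ed. (2006), I §0 Example 0.8. [MilneADT2006]
* C. A. Weibel, *An introduction to homological algebra* (1994), §2.4, Thm. 2.7.6. [Weibel1994]
-/

noncomputable section

universe u

namespace Literature.Algebra.Homology

namespace DiscreteRep

open CategoryTheory CategoryTheory.Limits CategoryTheory.Abelian TopRep

variable {k Γ : Type u} [CommRing k] [Group Γ] [TopologicalSpace Γ] [IsTopologicalGroup Γ]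
  (U : Subgroup Γ)

/-! ## §1 `Res Hom(N, P) = Hom(Res N, Res P)` and curry under restriction -/

section Curry

variable (N : DiscreteRepCat k Γ) [Module.Finite k N.obj.V] [Module.Finite k ((resD k U).obj N).obj.V]
  (P : DiscreteRepCat k Γ)

/-- **`Res_U Hom(N, P) = Hom(Res_U N, Res_U P)` in `C_U`**, definitionally (same linear maps, same
conjugation action restricted to `U`). [cite: Harari2020, §16.2 Definition 16.10 and §4.3 (2)] -/
theorem resD_ihomObj : (resD k U).obj (ihomObj N P) = ihomObj ((resD k U).obj N) ((resD k U).obj P) :=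
  rfl

variable {P} in
/-- `Res (Hom(N, h)) = Hom(Res N, Res h)`, definitionally. [cite: Harari2020, §16.2 Definition 16.11] -/
theorem resD_map_ihomFunctor_map {Q : DiscreteRepCat k Γ} (h : P ⟶ Q) :
    (resD k U).map ((ihomFunctor N).map h) = (ihomFunctor ((resD k U).obj N)).map ((resD k U).map h) :=
  rfl

variable {P} in
/-- `Res (curry f) = curry (Res f)` on `Hom`-level, definitionally.
[cite: Harari2020, §16.2 Theorem 16.14 (proof, (16.2))] -/
theorem resD_map_curryHom (f : N ⟶ P) :
    (resD k U).map (curryHom N f) = curryHom ((resD k U).obj N) ((resD k U).map f) := rfl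

variable {P} in
/-- **`curryExt₀` commutes with restriction**: `Res (curry x) = curry (Res x)` on `Ext⁰`.
[cite: Harari2020, §16.2 Theorem 16.14 (proof, (16.2)) and §4.3 (2)] -/
theorem curryExt₀_res (x : Ext N P 0) :
    (curryExt₀ N P x).mapExactFunctor (resD k U) =
      curryExt₀ ((resD k U).obj N) ((resD k U).obj P) (x.mapExactFunctor (resD k U)) := by
  obtain ⟨f, rfl⟩ : ∃ f : N ⟶ P, x = Ext.mk₀ f := ⟨Ext.addEquiv₀ x, (Ext.mk₀_addEquiv₀_apply x).symm⟩
  have h1 : Ext.addEquiv₀ (Ext.mk₀ f) = f := by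
    rw [← Ext.addEquiv₀_symm_apply, AddEquiv.apply_symm_apply]
  have h2 : Ext.addEquiv₀ (Ext.mk₀ ((resD k U).map f)) = (resD k U).map f := by
    rw [← Ext.addEquiv₀_symm_apply, AddEquiv.apply_symm_apply]
  simp only [curryExt₀, AddEquiv.trans_apply, curryHomAddEquiv_apply, Ext.mapExactFunctor_mk₀, h1, h2,
    Ext.addEquiv₀_symm_apply, resD_map_curryHom]
  -- the two sides now differ only by the definitional unfolding `Res Hom(N, P) = Hom(Res N, Res P)`
  rfl

/-- **`Res Hom(N, I•) = Hom(Res N, Res I•)` as cochain complexes** — the identity isomorphism between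
the two syntactic forms (used to keep the statements below syntactically well-typed; it is `Iso.refl`).
[cite: Harari2020, §16.2 Definition 16.11 and §4.3 (2)] -/
def resIhomComplexIso (I : CochainComplex (DiscreteRepCat k Γ) ℕ) :
    AcyclicResolution.mapComplex (resD k U)
        (((ihomFunctor N).mapHomologicalComplex (ComplexShape.up ℕ)).obj I) ≅
      ((ihomFunctor ((resD k U).obj N)).mapHomologicalComplex (ComplexShape.up ℕ)).obj
        (AcyclicResolution.mapComplex (resD k U) I) :=
  Iso.refl _

/-- Components of `resIhomComplexIso` are identities. [cite: Harari2020, §16.2 Definition 16.11] -/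
@[simp]
theorem resIhomComplexIso_hom_f (I : CochainComplex (DiscreteRepCat k Γ) ℕ) (n : ℕ) :
    (resIhomComplexIso U N I).hom.f n = 𝟙 _ := rfl

/-- `Ext⁰(X, ·)` on cochain maps is functorial (the abbreviation `extComplexMap` unfolded once).
[cite: Weibel1994, §2.4] -/
theorem extComplexMap_comp (Y : DiscreteRepCat k U) {I I' I'' : CochainComplex (DiscreteRepCat k U) ℕ}
    (φ : I ⟶ I') (ψ : I' ⟶ I'') :
    AcyclicResolution.extComplexMap Y (φ ≫ ψ) =
      AcyclicResolution.extComplexMap Y φ ≫ AcyclicResolution.extComplexMap Y ψ :=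
  Functor.map_comp _ _ _

/-- `Res_*` on `Ext⁰(triv k, I•)`, with its target typed over `triv k ∈ C_U` (`= Res (triv k)`
definitionally; the ascription fixes the syntactic form once and for all). [cite: Harari2020, §4.3 (2)] -/
abbrev extComplexTrivResMapF (I : CochainComplex (DiscreteRepCat k Γ) ℕ) :
    AcyclicResolution.extComplex (triv (Γ := Γ) k) I ⟶
      AcyclicResolution.extComplex (triv (Γ := U) k) (AcyclicResolution.mapComplex (resD k U) I) :=
  AcyclicResolution.extComplexMapF (resD k U) (triv (Γ := Γ) k) I

/-- **The curry isomorphism of `Ext⁰`-complexes commutes with restriction**: for a cochain complex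
`I` of `C_Γ`, `Res_* ≫ curry_U = curry_Γ ≫ Res_*` as cochain maps
`Ext⁰_{C_Γ}(N, I•) ⟶ Ext⁰_{C_U}(triv k, Hom(Res N, Res I•))` (up to the identity `resIhomComplexIso`).
[cite: Harari2020, §16.2 Theorem 16.14 (proof, (16.2)) and §4.3 (2)] -/
theorem extComplexCurryIso_hom_res (I : CochainComplex (DiscreteRepCat k Γ) ℕ) :
    AcyclicResolution.extComplexMapF (resD k U) N I ≫
        (extComplexCurryIso ((resD k U).obj N) (AcyclicResolution.mapComplex (resD k U) I)).hom =
      (extComplexCurryIso N I).hom ≫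
        extComplexTrivResMapF U (((ihomFunctor N).mapHomologicalComplex (ComplexShape.up ℕ)).obj I) ≫
        AcyclicResolution.extComplexMap (triv (Γ := U) k) (resIhomComplexIso U N I).hom := by
  ext n x
  change curryExt₀ ((resD k U).obj N) ((resD k U).obj (I.X n)) (x.mapExactFunctor (resD k U)) =
    ((curryExt₀ N (I.X n) x).mapExactFunctor (resD k U)).comp (Ext.mk₀ (𝟙 _)) (add_zero 0)
  rw [Ext.comp_mk₀_id]
  exact (curryExt₀_res U N x).symm

/-- Hence on homology. [cite: Harari2020, §16.2 Theorem 16.14 (proof, (16.2)) and §4.3 (2)] -/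
theorem extComplexCurryHomologyIso_hom_res (I : CochainComplex (DiscreteRepCat k Γ) ℕ) (n : ℕ) :
    HomologicalComplex.homologyMap (AcyclicResolution.extComplexMapF (resD k U) N I) n ≫
        (extComplexCurryHomologyIso ((resD k U).obj N) (AcyclicResolution.mapComplex (resD k U) I) n).hom =
      (extComplexCurryHomologyIso N I n).hom ≫
        HomologicalComplex.homologyMap
          (extComplexTrivResMapF U (((ihomFunctor N).mapHomologicalComplex (ComplexShape.up ℕ)).obj I)) n ≫
        HomologicalComplex.homologyMap
          (AcyclicResolution.extComplexMap (triv (Γ := U) k) (resIhomComplexIso U N I).hom) n := by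
  have h := congrArg (fun φ => HomologicalComplex.homologyMap φ n) (extComplexCurryIso_hom_res U N I)
  rw [HomologicalComplex.homologyMap_comp, HomologicalComplex.homologyMap_comp,
    HomologicalComplex.homologyMap_comp] at h
  exact h

end Curry

/-! ## §2 The two engines under restriction -/

section EngineSrc

variable [TopologicalSpace k] [CompactSpace Γ] [CompactSpace U] (N : DiscreteRepCat k Γ)
  (X : TopRep.{u} k Γ) [DiscreteTopology X.V] (hX : IsDiscrete ((forgetTop k Γ).obj X))

/-- The composite cochain map on the `N` side:
`Ext⁰_{C_Γ}(N, std•X) → Ext⁰_{C_U}(Res N, Res std•X) → Ext⁰_{C_U}(Res N, std•_U Res X)`.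
[cite: Harari2020, §4.3 Remark 4.24] -/
abbrev extComplexSrcResMap :
    AcyclicResolution.extComplex N (stdComplex X hX) ⟶
      AcyclicResolution.extComplex ((resD k U).obj N)
        (stdComplex (resTop U X) (isDiscrete_resTop U hX)) :=
  AcyclicResolution.extComplexMapF (resD k U) N (stdComplex X hX) ≫
    AcyclicResolution.extComplexMap ((resD k U).obj N) (stdComplexResMap U hX)

variable (hN : ∀ n q (e : Ext N ((stdComplex X hX).X n) (q + 1)), e = 0)
  (hNr : ∀ n q (e : Ext ((resD k U).obj N)
    ((AcyclicResolution.mapComplex (resD k U) (stdComplex X hX)).X n) (q + 1)), e = 0)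
  (hN' : ∀ n q (e : Ext ((resD k U).obj N)
    ((stdComplex (resTop U X) (isDiscrete_resTop U hX)).X n) (q + 1)), e = 0)

include hNr in
/-- **`extAddEquivStdHomology` commutes with restriction** (the engine on `std• X` in the source `N`:
functoriality under `Res`, then naturality along `Res std•_Γ X → std•_U Res X`; `hN`, `hNr`, `hN'` = the
three acyclicity inputs). [cite: Harari2020, §4.3 Remark 4.24 and §16.2 Theorem 16.14] -/
theorem extAddEquivStdHomology_res (n : ℕ) (x : Ext N (stdBase X hX) n) :
    (HomologicalComplex.homologyMap (extComplexSrcResMap U N X hX) n).hom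
        (extAddEquivStdHomology N X hX hN n x) =
      extAddEquivStdHomology ((resD k U).obj N) (resTop U X) (isDiscrete_resTop U hX) hN' n
        (x.mapExactFunctor (resD k U)) := by
  -- the engine's `Mono` instances, registered locally (no reducibility tweaks)
  haveI : Mono (stdη X hX) := mono_stdη X hX
  haveI : Mono ((resD k U).map (stdη X hX)) := (resD k U).map_mono (stdη X hX)
  haveI := AcyclicResolution.mono_map_augmentation (resD k U) (stdComplex X hX) (stdη X hX)
  haveI : Mono (stdη (resTop U X) (isDiscrete_resTop U hX)) := mono_stdη (resTop U X) (isDiscrete_resTop U hX)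
  rw [HomologicalComplex.homologyMap_comp]
  change (HomologicalComplex.homologyMap (AcyclicResolution.extComplexMap ((resD k U).obj N)
      (stdComplexResMap U hX)) n).hom
      ((HomologicalComplex.homologyMap (AcyclicResolution.extComplexMapF (resD k U) N
        (stdComplex X hX)) n).hom (extAddEquivStdHomology N X hX hN n x)) = _
  cases n with
  | zero =>
    have hA := AcyclicResolution.extAddEquivHomologyZero_map (resD k U) N
      (stdComplex X hX) (stdη X hX) (stdη_d X hX) (exact_stdη X hX) x
    have hB := AcyclicResolution.extAddEquivHomologyZero_naturality ((resD k U).obj N)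
      (stdComplexResMap U hX) ((resD k U).map (stdη X hX))
      (AcyclicResolution.map_hη (resD k U) (stdComplex X hX) (stdη X hX) (stdη_d X hX))
      (AcyclicResolution.map_exact_augmentation (resD k U) (stdComplex X hX) (stdη X hX) (stdη_d X hX)
        (exact_stdη X hX))
      (stdη (resTop U X) (isDiscrete_resTop U hX)) (stdη_d (resTop U X) (isDiscrete_resTop U hX))
      (exact_stdη (resTop U X) (isDiscrete_resTop U hX)) (𝟙 _) (stdη_res U hX)
      (x.mapExactFunctor (resD k U))
    exact ((congrArg _ hA).trans hB).trans (congrArg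
      (extAddEquivStdHomology ((resD k U).obj N) (resTop U X) (isDiscrete_resTop U hX) hN' 0)
      (Ext.comp_mk₀_id _))
  | succ n =>
    have hA := AcyclicResolution.extAddEquivHomologySucc_map (resD k U) N
      (stdComplex X hX) (stdη X hX) (stdη_d X hX) (exact_stdη X hX) (stdComplex_exactAt_succ X hX)
      hN hNr n x
    have hB := AcyclicResolution.extAddEquivHomologySucc_naturality ((resD k U).obj N)
      (stdComplexResMap U hX) ((resD k U).map (stdη X hX))
      (AcyclicResolution.map_hη (resD k U) (stdComplex X hX) (stdη X hX) (stdη_d X hX))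
      (AcyclicResolution.map_exact_augmentation (resD k U) (stdComplex X hX) (stdη X hX) (stdη_d X hX)
        (exact_stdη X hX))
      (stdη (resTop U X) (isDiscrete_resTop U hX)) (stdη_d (resTop U X) (isDiscrete_resTop U hX))
      (exact_stdη (resTop U X) (isDiscrete_resTop U hX)) (𝟙 _) (stdη_res U hX)
      (AcyclicResolution.map_exactAt (resD k U) (stdComplex X hX) (stdComplex_exactAt_succ X hX))
      hNr (stdComplex_exactAt_succ (resTop U X) (isDiscrete_resTop U hX)) hN' n
      (x.mapExactFunctor (resD k U))
    exact ((congrArg _ hA).trans hB).trans (congrArg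
      (extAddEquivStdHomology ((resD k U).obj N) (resTop U X) (isDiscrete_resTop U hX) hN' (n + 1))
      (Ext.comp_mk₀_id _))

end EngineSrc

section Engines

variable [TopologicalSpace k] [CompactSpace Γ] [CompactSpace U]
  (N : DiscreteRepCat k Γ) [Module.Finite k N.obj.V] [Module.Finite k ((resD k U).obj N).obj.V]
  (X : TopRep.{u} k Γ) [DiscreteTopology X.V] (hX : IsDiscrete ((forgetTop k Γ).obj X))

/-- The cochain map `Hom(Res N, Res std•_Γ X → std•_U Res X)` in `C_U` (its source is
`Res Hom(N, std•_Γ X)`, definitionally). [cite: Harari2020, §4.3 Remark 4.24 and §16.2] -/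
abbrev ihomStdComplexResMap :
    AcyclicResolution.mapComplex (resD k U) (ihomStdComplex N X hX) ⟶
      ihomStdComplex ((resD k U).obj N) (resTop U X) (isDiscrete_resTop U hX) :=
  (resIhomComplexIso U N (stdComplex X hX)).hom ≫
    ((ihomFunctor ((resD k U).obj N)).mapHomologicalComplex (ComplexShape.up ℕ)).map
      (stdComplexResMap U hX)

/-- The augmentations of the `Hom` complexes are compatible with restriction:
`Res η_{Hom} ≫ (Hom res-map)⁰ = 𝟙 ≫ η_{Hom, U}`. [cite: Harari2020, §4.3 Remark 4.24] -/
theorem ihomStdη_res :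
    (resD k U).map (ihomStdη N X hX) ≫ (ihomStdComplexResMap U N X hX).f 0 =
      𝟙 _ ≫ ihomStdη ((resD k U).obj N) (resTop U X) (isDiscrete_resTop U hX) := by
  rw [Category.id_comp]
  change (ihomFunctor ((resD k U).obj N)).map ((resD k U).map (stdη X hX)) ≫ 𝟙 _ ≫
      (ihomFunctor ((resD k U).obj N)).map ((stdComplexResMap U hX).f 0) =
    (ihomFunctor ((resD k U).obj N)).map (stdη (resTop U X) (isDiscrete_resTop U hX))
  rw [Category.id_comp, ← Functor.map_comp, stdη_res, Category.id_comp]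
  rfl

/-- The composite cochain map on the `Hom` side:
`Ext⁰_{C_Γ}(k, Hom(N, std•X)) → Ext⁰_{C_U}(k, Res Hom(N, std•X)) → Ext⁰_{C_U}(k, Hom(Res N, std•_U Res X))`.
[cite: Harari2020, §4.3 Remark 4.24] -/
abbrev extComplexIhomResMap :
    AcyclicResolution.extComplex (triv (Γ := Γ) k) (ihomStdComplex N X hX) ⟶
      AcyclicResolution.extComplex (triv (Γ := U) k)
        (ihomStdComplex ((resD k U).obj N) (resTop U X) (isDiscrete_resTop U hX)) :=
  extComplexTrivResMapF U (ihomStdComplex N X hX) ≫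
    AcyclicResolution.extComplexMap (triv (Γ := U) k) (ihomStdComplexResMap U N X hX)

variable (hHr : ∀ n q (e : Ext (triv (k := k) (Γ := U) k)
    ((AcyclicResolution.mapComplex (resD k U) (ihomStdComplex N X hX)).X n) (q + 1)), e = 0)

include hHr in
/-- **`extTrivIhomAddEquivHomology` commutes with restriction** (the engine on `Hom(N, std•X)` in the
source `triv k`: functoriality under `Res`, then naturality along the `Hom` res-map; `hHr` = the terms
`Res Hom(N, stdⁿ X)` are `Ext_{C_U}(k, –)`-acyclic). [cite: Harari2020, §4.3 Remark 4.24 and §16.2 Theorem 16.14] -/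
theorem extTrivIhomAddEquivHomology_res (n : ℕ) (y : Ext (triv (Γ := Γ) k) (ihomObj N (stdBase X hX)) n) :
    (HomologicalComplex.homologyMap (extComplexIhomResMap U N X hX) n).hom
        (extTrivIhomAddEquivHomology N X hX n y) =
      extTrivIhomAddEquivHomology ((resD k U).obj N) (resTop U X) (isDiscrete_resTop U hX) n
        (y.mapExactFunctor (resD k U)) := by
  haveI := mono_ihomStdη N X hX
  haveI : Mono ((resD k U).map (ihomStdη N X hX)) := (resD k U).map_mono (ihomStdη N X hX)
  haveI := AcyclicResolution.mono_map_augmentation (resD k U) (ihomStdComplex N X hX) (ihomStdη N X hX)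
  haveI := mono_ihomStdη ((resD k U).obj N) (resTop U X) (isDiscrete_resTop U hX)
  rw [HomologicalComplex.homologyMap_comp]
  change (HomologicalComplex.homologyMap (AcyclicResolution.extComplexMap (triv (Γ := U) k)
      (ihomStdComplexResMap U N X hX)) n).hom
      ((HomologicalComplex.homologyMap (AcyclicResolution.extComplexMapF (resD k U) (triv (Γ := Γ) k)
        (ihomStdComplex N X hX)) n).hom (extTrivIhomAddEquivHomology N X hX n y)) = _
  cases n with
  | zero =>
    have hA := AcyclicResolution.extAddEquivHomologyZero_map (resD k U) (triv (Γ := Γ) k)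
      (ihomStdComplex N X hX) (ihomStdη N X hX) (ihomStdη_d N X hX) (exact_ihomStdη N X hX) y
    have hB := AcyclicResolution.extAddEquivHomologyZero_naturality (triv (Γ := U) k)
      (ihomStdComplexResMap U N X hX) ((resD k U).map (ihomStdη N X hX))
      (AcyclicResolution.map_hη (resD k U) (ihomStdComplex N X hX) (ihomStdη N X hX) (ihomStdη_d N X hX))
      (AcyclicResolution.map_exact_augmentation (resD k U) (ihomStdComplex N X hX) (ihomStdη N X hX)
        (ihomStdη_d N X hX) (exact_ihomStdη N X hX))
      (ihomStdη ((resD k U).obj N) (resTop U X) (isDiscrete_resTop U hX))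
      (ihomStdη_d ((resD k U).obj N) (resTop U X) (isDiscrete_resTop U hX))
      (exact_ihomStdη ((resD k U).obj N) (resTop U X) (isDiscrete_resTop U hX)) (𝟙 _)
      (ihomStdη_res U N X hX) (y.mapExactFunctor (resD k U))
    exact ((congrArg _ hA).trans hB).trans (congrArg
      (extTrivIhomAddEquivHomology ((resD k U).obj N) (resTop U X) (isDiscrete_resTop U hX) 0)
      (Ext.comp_mk₀_id _))
  | succ n =>
    have hA := AcyclicResolution.extAddEquivHomologySucc_map (resD k U) (triv (Γ := Γ) k)
      (ihomStdComplex N X hX) (ihomStdη N X hX) (ihomStdη_d N X hX) (exact_ihomStdη N X hX)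
      (ihomStdComplex_exactAt_succ N X hX) (ext_triv_ihomStdComplex_X_eq_zero N X hX) hHr n y
    have hB := AcyclicResolution.extAddEquivHomologySucc_naturality (triv (Γ := U) k)
      (ihomStdComplexResMap U N X hX) ((resD k U).map (ihomStdη N X hX))
      (AcyclicResolution.map_hη (resD k U) (ihomStdComplex N X hX) (ihomStdη N X hX) (ihomStdη_d N X hX))
      (AcyclicResolution.map_exact_augmentation (resD k U) (ihomStdComplex N X hX) (ihomStdη N X hX)
        (ihomStdη_d N X hX) (exact_ihomStdη N X hX))
      (ihomStdη ((resD k U).obj N) (resTop U X) (isDiscrete_resTop U hX))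
      (ihomStdη_d ((resD k U).obj N) (resTop U X) (isDiscrete_resTop U hX))
      (exact_ihomStdη ((resD k U).obj N) (resTop U X) (isDiscrete_resTop U hX)) (𝟙 _)
      (ihomStdη_res U N X hX)
      (AcyclicResolution.map_exactAt (resD k U) (ihomStdComplex N X hX) (ihomStdComplex_exactAt_succ N X hX))
      hHr (ihomStdComplex_exactAt_succ ((resD k U).obj N) (resTop U X) (isDiscrete_resTop U hX))
      (ext_triv_ihomStdComplex_X_eq_zero ((resD k U).obj N) (resTop U X) (isDiscrete_resTop U hX)) n
      (y.mapExactFunctor (resD k U))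
    exact ((congrArg _ hA).trans hB).trans (congrArg
      (extTrivIhomAddEquivHomology ((resD k U).obj N) (resTop U X) (isDiscrete_resTop U hX) (n + 1))
      (Ext.comp_mk₀_id _))

/-! ## §3 The comparison `extIhomAddEquiv` under restriction -/

variable (hN : ∀ n q (e : Ext N ((stdComplex X hX).X n) (q + 1)), e = 0)
  (hNr : ∀ n q (e : Ext ((resD k U).obj N)
    ((AcyclicResolution.mapComplex (resD k U) (stdComplex X hX)).X n) (q + 1)), e = 0)
  (hN' : ∀ n q (e : Ext ((resD k U).obj N)
    ((stdComplex (resTop U X) (isDiscrete_resTop U hX)).X n) (q + 1)), e = 0)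

/-- The curry square between the two composite res-maps, on homology:
`Hⁿ(src-res) ≫ curry_U = curry_Γ ≫ Hⁿ(Hom-res)`. [cite: Harari2020, §16.2 Theorem 16.14 (proof) and §4.3 (2)] -/
theorem extComplexCurryHomologyIso_hom_resMap (n : ℕ) :
    HomologicalComplex.homologyMap (extComplexSrcResMap U N X hX) n ≫
        (extComplexCurryHomologyIso ((resD k U).obj N)
          (stdComplex (resTop U X) (isDiscrete_resTop U hX)) n).hom =
      (extComplexCurryHomologyIso N (stdComplex X hX) n).hom ≫
        HomologicalComplex.homologyMap (extComplexIhomResMap U N X hX) n := by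
  change HomologicalComplex.homologyMap _ n ≫ HomologicalComplex.homologyMap _ n =
    HomologicalComplex.homologyMap _ n ≫ HomologicalComplex.homologyMap _ n
  rw [← HomologicalComplex.homologyMap_comp, ← HomologicalComplex.homologyMap_comp]
  congr 1
  rw [Category.assoc, extComplexCurryIso_hom_naturality ((resD k U).obj N) (stdComplexResMap U hX),
    ← Category.assoc, extComplexCurryIso_hom_res, Category.assoc, Category.assoc, ← extComplexMap_comp]

include hHr hNr in
/-- **THE COMPARISON `Extⁿ_{C_Γ}(N, X) ≃+ Extⁿ_{C_Γ}(triv k, Hom(N, X))` COMMUTES WITH RESTRICTION**: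
`Res (extIhomAddEquiv N X x) = extIhomAddEquiv (Res N) (Res X) (Res x)` in
`Extⁿ_{C_U}(triv k, Hom(Res N, Res X)) = Extⁿ_{C_U}(triv k, Res Hom(N, X))`.
[cite: Harari2020, §16.2 Proposition 16.16 (b) and §4.3 (2)] -/
theorem extIhomAddEquiv_res (n : ℕ) (x : Ext N (stdBase X hX) n) :
    (extIhomAddEquiv N X hX hN n x).mapExactFunctor (resD k U) =
      extIhomAddEquiv ((resD k U).obj N) (resTop U X) (isDiscrete_resTop U hX) hN' n
        (x.mapExactFunctor (resD k U)) := by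
  set E := extTrivIhomAddEquivHomology N X hX n with hE
  set E' := extTrivIhomAddEquivHomology ((resD k U).obj N) (resTop U X) (isDiscrete_resTop U hX) n
    with hE'
  -- unfold both `extIhomAddEquiv`s and restrict the `std`-engine
  change (E.symm ((extComplexCurryHomologyIso N (stdComplex X hX) n).addCommGroupIsoToAddEquiv
      (extAddEquivStdHomology N X hX hN n x))).mapExactFunctor (resD k U) = E'.symm ((extComplexCurryHomologyIso ((resD k U).obj N)
      (stdComplex (resTop U X) (isDiscrete_resTop U hX)) n).addCommGroupIsoToAddEquiv
      (extAddEquivStdHomology ((resD k U).obj N) (resTop U X) (isDiscrete_resTop U hX) hN' n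
        (x.mapExactFunctor (resD k U))))
  rw [← extAddEquivStdHomology_res U N X hX hN hNr hN' n x]
  -- the curry square on homology, applied to the element
  have hsq := congrArg (fun f => f.hom (extAddEquivStdHomology N X hX hN n x))
    (extComplexCurryHomologyIso_hom_resMap U N X hX n)
  change (extComplexCurryHomologyIso ((resD k U).obj N)
      (stdComplex (resTop U X) (isDiscrete_resTop U hX)) n).addCommGroupIsoToAddEquiv
      ((HomologicalComplex.homologyMap (extComplexSrcResMap U N X hX) n).hom
        (extAddEquivStdHomology N X hX hN n x)) =
    (HomologicalComplex.homologyMap (extComplexIhomResMap U N X hX) n).hom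
      ((extComplexCurryHomologyIso N (stdComplex X hX) n).addCommGroupIsoToAddEquiv
        (extAddEquivStdHomology N X hX hN n x)) at hsq
  rw [hsq]
  -- the `Hom`-engine square in inverse form
  apply E'.injective
  rw [AddEquiv.apply_symm_apply, ← extTrivIhomAddEquivHomology_res U N X hX hHr n, AddEquiv.apply_symm_apply]

end Engines

end DiscreteRep

end Literature.Algebra.Homology
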